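import Summits.ABC.IUTFork.Cor312LogKummerRoute
import HarnessLib

/-!
# [IUTchIII] Corollary 3.12 — the log-Kummer route at PRINT'S QUANTIFIER LEVEL: one global volume inequality
# (proof-only companion of TEAM B's `Cor312LogKummerRoute`, ADJUDICATION-SPEC §2 (G1′))

Record-only file (D-0012) of the abc-iut cell (wave-4 prover abc-iut-w4-d022, dag-default audit of TEAM B
row B-1; TAKES NO SIDE). abc-iut-c312-11's `Cor312Vol.statement_of_volumeTransport` (p411119) derives the
printed Statement of [IUTchIII] Cor. 3.12 (kurims `paper:url-4b091feeb646`, p. 174 l. 16–18) from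
`BridgeHyps ∧ ThetaRegionsAdm ∧ VolumeTransport`, where the B-INPUT `VolumeTransport` is a PER-PACKET
statement: `∀ (j, v_ℚ), ∃ m, −|log(q)|_{j,v_ℚ} ≤ μ^log(thetaRegion m)_{j,v_ℚ}`. abc-iut-plan's ADJUDICATION-SPEC
§2 (G1′) / §4 (ii) records that print's Step (xi-g) (p. 184 l. 30–34, "two tautologically equivalent ways to
compute the log-volume of the `q`-pilot object at `(1,0)`") compares TWO GLOBAL REAL NUMBERS — the
procession-normalised, `v_ℚ`-summed log-volumes — and that Step (xii) (p. 185 l. 59 – p. 186 l. 3) calls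
per-place computations "rendered meaningless"; a per-packet gap statement is therefore STRONGER-THAN-PRINT
in quantifier level. This file supplies the route at print's level, over the same frozen objects and with
NO new definition and NO new `Prop` fact (every hypothesis is inline):

* `logvol_thetaRegion_le_thetaLocal` — per packet, the log-volume of EVERY single Kummer image `thetaRegion m`
  is at most the hull contribution `thetaLocal` (monotonicity into the packet hull; B-1's
  `thetaRegion_subset_thetaHull` + `BridgeHyps.mono`).
* `statement_of_globalVolumeTransport` — **THE ROUTE AT GLOBAL LEVEL**: `BridgeHyps ∧ ThetaRegionsAdm` and,
  for SOME choice of lattice positions `m(j, v_ℚ)` whose Kummer-image log-volumes are finitely supported over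
  `v_ℚ` (Prop. 3.9 (iii)-type side condition, needed only because `∑ᶠ` reads junk on infinite support), the
  ONE global inequality `−|log(q)| ≤ procession-normalised ∑ᶠ_{v_ℚ} μ^log(thetaRegion (m j v_ℚ))` ⟹ the printed
  Statement. Nothing per-packet is compared between the `q`- and Θ-sides.
* `globalVolumeTransport_of_pointwise` — the global hypothesis is IMPLIED by the per-packet one (with the same
  finite-support side condition), so the global B-INPUT is formally the WEAKER gap candidate; the converse is
  not claimed (sums do not control terms).
* Non-vacuity on c312-6's nonempty toy (`statement_toySettingNE_global`).

HONEST SCOPE: bookkeeping over the frozen `Cor312.Setting`; whether either form of the B-INPUT follows from the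
typed Thm. 3.11 + the frozen FACT LIST is Team B's adjudication and is NOT touched; the weakest global hypothesis
of all is the Statement's own inequality, so the content of this file is only the quantifier bookkeeping that
lets a GAP row be written at print's level. [claim: Mochizuki2012, status: disputed] for the Corollary.
-/

noncomputable section

namespace Summit.ABC

namespace IUTFork

namespace Cor312Vol

open Thm311 Cor312 Literature.IUT.LogThetaLattice

variable {T : ThetaIndex} {S : Situation T} {P : Cor312.Setting S}

/-- Per packet `(j = i+1, v_ℚ)`: under the bridge hypotheses and admissibility of the Kummer images, the
log-volume of the single Kummer image `thetaRegion m` is at most the hull contribution `thetaLocal` read as a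
real number ([IUTchIII] proof of Cor. 3.12, p. 174 l. 50 – p. 175 l. 1: each image lies in the hull of the
union of the possible images; Prop. 3.9 (i) monotonicity). [folklore] -/
theorem logvol_thetaRegion_le_thetaLocal (H : BridgeHyps P) (hadm : ThetaRegionsAdm P) (m : ℤ)
    (i : Fin T.lstar) (vQ : T.VQ) :
    (S.D P.n).logvol (Setting.labelSucc i) vQ (P.thetaRegion m (Setting.labelSucc i) vQ) ≤
      (P.thetaLocal (Setting.labelSucc i) vQ).untopD 0 := by
  rw [thetaLocal_untopD H]
  exact H.mono i vQ (hadm m i vQ) (P.thetaHull_adm (hullDefined_of_finite H i vQ))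
    (thetaRegion_subset_thetaHull P m _ vQ)

/-- **THE LOG-KUMMER ROUTE AT PRINT'S QUANTIFIER LEVEL** ([IUTchIII] Cor. 3.12 Step (xi-g), p. 184
l. 30–34, read as ONE comparison of global reals): under `BridgeHyps` and `ThetaRegionsAdm`, if for some
choice of lattice positions `m(j, v_ℚ)` — whose Kummer-image log-volumes are finitely supported over `v_ℚ` at
each label — the GLOBAL quantity `−|log(q)|` is at most the procession-normalised global log-volume of the
chosen Kummer images of the Θ-pilot object, then the printed Statement holds: `−|log(Θ)| ∈ ℝ` and
`−|log(q)| ≤ −|log(Θ)|`. Proof: the chosen images are termwise bounded by the packet hulls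
(`logvol_thetaRegion_le_thetaLocal`), then `∑ᶠ` and the average are monotone (B-1's
`processionNormalized_mono`). Every hypothesis is named inline; nothing is asserted.
[claim: Mochizuki2012, status: disputed] -/
theorem statement_of_globalVolumeTransport (H : BridgeHyps P) (hadm : ThetaRegionsAdm P)
    (m : Fin T.lstar → T.VQ → ℤ)
    (hsupp : ∀ i : Fin T.lstar, (Function.support fun vQ : T.VQ =>
      (S.D P.n).logvol (Setting.labelSucc i) vQ (P.thetaRegion (m i vQ) (Setting.labelSucc i) vQ)).Finite)
    (hglob : P.negLogQ ≤ processionNormalized fun i : Fin T.lstar => ∑ᶠ vQ : T.VQ,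
      (S.D P.n).logvol (Setting.labelSucc i) vQ (P.thetaRegion (m i vQ) (Setting.labelSucc i) vQ)) :
    P.Statement := by
  constructor
  · unfold Setting.negLogTheta
    rw [if_pos H.finite]
    exact WithTop.coe_ne_top
  · unfold Setting.negLogTheta
    rw [if_pos H.finite, WithTop.coe_le_coe]
    refine hglob.trans (processionNormalized_mono fun i => ?_)
    exact finsum_le_finsum' (hsupp i) (H.finite.2 i)
      fun vQ => logvol_thetaRegion_le_thetaLocal H hadm (m i vQ) i vQ

/-- **The global hypothesis is the WEAKER gap candidate**: a per-packet comparison against a chosen family of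
Kummer images (`∀ (j, v_ℚ), −|log(q)|_{j,v_ℚ} ≤ μ^log(thetaRegion (m j v_ℚ))`, i.e. B-1's `VolumeTransport` with
the positions made explicit) IMPLIES the one global inequality, given the same finite-support side condition
(`−|log(q)|` is finitely supported by `Setting.qSupport_finite`, Prop. 3.9 (iii)). The converse is not claimed.
[folklore] -/
theorem globalVolumeTransport_of_pointwise (m : Fin T.lstar → T.VQ → ℤ)
    (hvt : ∀ (i : Fin T.lstar) (vQ : T.VQ), P.qLocal (Setting.labelSucc i) vQ ≤
      (S.D P.n).logvol (Setting.labelSucc i) vQ (P.thetaRegion (m i vQ) (Setting.labelSucc i) vQ))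
    (hsupp : ∀ i : Fin T.lstar, (Function.support fun vQ : T.VQ =>
      (S.D P.n).logvol (Setting.labelSucc i) vQ (P.thetaRegion (m i vQ) (Setting.labelSucc i) vQ)).Finite) :
    P.negLogQ ≤ processionNormalized fun i : Fin T.lstar => ∑ᶠ vQ : T.VQ,
      (S.D P.n).logvol (Setting.labelSucc i) vQ (P.thetaRegion (m i vQ) (Setting.labelSucc i) vQ) := by
  unfold Setting.negLogQ
  exact processionNormalized_mono fun i =>
    finsum_le_finsum' (qLocal_support_finite (P := P) _) (hsupp i) fun vQ => hvt i vQ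

/-- Sanity / dictionary: the per-packet route of B-1 factors through the global one — from a per-packet
family with finitely supported volumes one gets the Statement via `statement_of_globalVolumeTransport`.
[folklore] -/
theorem statement_of_pointwise_family (H : BridgeHyps P) (hadm : ThetaRegionsAdm P)
    (m : Fin T.lstar → T.VQ → ℤ)
    (hvt : ∀ (i : Fin T.lstar) (vQ : T.VQ), P.qLocal (Setting.labelSucc i) vQ ≤
      (S.D P.n).logvol (Setting.labelSucc i) vQ (P.thetaRegion (m i vQ) (Setting.labelSucc i) vQ))
    (hsupp : ∀ i : Fin T.lstar, (Function.support fun vQ : T.VQ =>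
      (S.D P.n).logvol (Setting.labelSucc i) vQ (P.thetaRegion (m i vQ) (Setting.labelSucc i) vQ)).Finite) :
    P.Statement :=
  statement_of_globalVolumeTransport H hadm m hsupp (globalVolumeTransport_of_pointwise m hvt hsupp)

/-! ### Non-vacuity on the nonempty toy -/

namespace Checks

/-- On c312-6's nonempty toy (all log-volumes `0`) the global hypotheses hold at `m ≡ 0` (empty support,
`0 ≤ 0`) and the global route yields the Statement. [folklore] -/
theorem statement_toySettingNE_global : toySettingNE.Statement := by
  refine statement_of_globalVolumeTransport bridgeHyps_toySettingNE thetaRegionsAdm_toySettingNE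
    (fun _ _ => 0) (fun _ => Set.toFinite _) ?_
  exact globalVolumeTransport_of_pointwise (P := toySettingNE) (fun _ _ => 0)
    (fun i vQ => volumeTransportAt_toySettingNE i vQ) fun _ => Set.toFinite _

end Checks

end Cor312Vol

end IUTFork

end Summit.ABC

end
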